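import Summits.ValiantsHypothesis.ValiantsHypothesis.Theorems.KPlusLogSqLawTridiagonalRealStaticCutLaw
import Summits.ValiantsHypothesis.ValiantsHypothesis.Theorems.KPlusLogSqLawTridiagonalRealStaticPotentialCells

/-!
# Route «KPlusLogSqLaw», crux `WeakLifting` (stmt-ValiantsHypothesis-19561) — REAL side of the tridiagonal sector:
# the OVERLAP IDENTITY of the static symmetric tridiagonal continuant (all sizes, every interior vertex) and the
# FIVE-BY-FIVE PRODUCT FORM «D₁₂₃ · D₃₄₅ = b₁² b₂² a₀ a₄ · x^{…} > 0 at every positive determinant zero»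

HONEST FRAMING.  Helper theorems (`--supports stmt-ValiantsHypothesis-19561 --as helper`), seat val-sym-lift-p3 (g11), cell `pub-symmetroid`,
2026-08-28, on the REAL side of the desk's typed α target (lead R2102/R2114: a real symmetric TRIDIAGONAL matrix of MONOMIALS with positive
diagonal coefficients has at most `B m` positive determinant zeros, `B` explicit and linear).  That target is NOT proved here, and NO zero
is counted here.  This file is STRUCTURE for the `m = 5` row of the α register (the cell holds `B 5 ≥ 5`, `…TridiagonalRealStaticFive`;
`B 5 ≤ 7` by Descartes, `…TridiagonalRealStaticDescartesRow`; the located value is `5`) and for the `(P)_3` rung of lift-p3 g10's conditional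
row (`…TridiagonalRealStaticPotentialRow`): the companion of val-sym-lift-p1 g13's two-sided EDGE splitting (`StaticTridiagonalRealCut.ctK_split`,
`pathDet_split_two_sided`: the blocks `[0, s]` and `[s+1, m)` on either side of an edge) is the VERTEX version below — the two principal
blocks OVERLAPPING in one vertex.  Nothing here bears on `WeakLifting` / `TropicalB` (stmt-19771) in their windows, on Conjecture B, on
the Door-A registers, on `MatrixDescartes` (stmt-ValiantsHypothesis-18050) or on VP ≠ VNP; α status NO MOVER.

WHAT IS PROVED (continuant currency `D_k = pathDet a d b f k` of `…TridiagonalRealStaticPotentialDefs`; `D⁽ᵘ⁾` = the continuant of the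
design shifted by `u`, i.e. of the trailing block starting at vertex `u`).
1. **`pathDet_overlap` — THE OVERLAP IDENTITY (all `s, n`; size `m = s + 3 + n`, cut vertex `c = s + 1` in `0`-based numbering):**
   `D_{s+2} · D⁽ˢ⁺¹⁾_{n+2} = a_c X^{d_c} · D_m + (b_s X^{f_s})² (b_{s+1} X^{f_{s+1}})² · D_s · D⁽ˢ⁺³⁾_n`
   — the product of the two principal blocks `[0, c]` and `[c, m)` sharing the vertex `c` is the diagonal entry at `c` times the whole
   determinant plus the two link weights at `c` times the blocks `[0, c−1)` and `(c+1, m)`.  (A three-term Plücker-type relation; from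
   lift-p1's edge splitting at the two edges of `c` and the recurrence.)  `eval_pathDet_overlap` is the evaluated form.
2. **`overlap_law` — at every zero `x` of `D_m`:** `D_{s+2}(x) · D⁽ˢ⁺¹⁾_{n+2}(x) = (b_s x^{f_s})² (b_{s+1} x^{f_{s+1}})² · D_s(x) · D⁽ˢ⁺³⁾_n(x)`;
   hence the two overlapping blocks and the two outer blocks have products of the SAME weak sign (`overlap_sameSign`), strictly when the
   links are nonzero, `x ≠ 0` and the outer product is nonzero (`overlap_pos_iff`).
3. **`m = 5` (`s = n = 1`, the middle vertex): the PRODUCT FORM.**  For a definite (`0 < a`) irreducible (`b ≠ 0`) design and a positive zero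
   `x` of `D₅`:  `D₃(x) · D⁽²⁾₃(x) = (b₁x^{f₁})²(b₂x^{f₂})² · a₀x^{d₀} · a₄x^{d₄} > 0` (`five_overlap_eq`, `five_overlap_pos`) — the leading and the
   trailing `3 × 3` minors are NONZERO and of the SAME SIGN at every positive determinant zero (`five_trailing_three_ne_zero`); and the SIGN IS
   THE INERTIA CLASS: `0 < D₃(x)` iff all proper leading minors are positive at `x` (`five_class_zero_iff`, class `0` — the bottom class of
   `…StaticTridiagonalDefiniteInterval`, at most two such zeros), while `D₃(x) < 0` forces `D₄(x) < 0 < D₁(x)` (`five_class_one`: exactly one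
   sign change along `D₀, …, D₄`, class `1`; the class range at `m = 5` is `{0, 1}`).  So the positive zeros of a `5 × 5` design split as
   «both overlapping `3 × 3` minors positive» (≤ 2 of them, kernel) ⊔ «both negative» (the located bulk: the boost design of
   `…TridiagonalRealStaticFive` has all five zeros there).
LOCATED, NOT CLAIMED (seat tools, pure python; memo OVERLAP-FIVE-liftp3g11.md): in the normalised variables `U_i` (link weight over the two
adjacent diagonal entries, a monomial in `x`) the zeros of `D₅` are the solutions of `(1 − U₁ − U₂)(1 − U₃ − U₄) = U₂U₃`, equivalently
`U₂/(1 − U₁) + U₃/(1 − U₄) = 1` (Schur complement at the middle vertex); a random census of `5 × 5` designs by the signs of `1 − U₁`, `1 − U₄`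
at the zeros found at most `2 / 4 / 4 / 0` zeros in the regions `(+,+) / (+,−) / (−,+) / (−,−)` and never more than `5` in total; an annealed
search for a sixth zero (integer exponents `≤ 6`, Descartes sign alternation `≥ 6` prefiltered) found none.  `B 5 = 5` remains LOCATED.
[folklore: continuants / three-term Plücker relations for tridiagonal minors; the `m = 5` sign/class statements are this seat's bookkeeping]
-/

-- `Summit.ValiantsHypothesis.ValiantsHypothesis.…` repeats a component by the D-0017 layout (single-conjunct summit); the name is mandated.
set_option linter.dupNamespace false
set_option autoImplicit false

namespace Summit.ValiantsHypothesis.ValiantsHypothesis.Theorems.KPlusLogSqLaw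

namespace StaticTridiagonalRealOverlap

open Polynomial
open Summit.ValiantsHypothesis.ValiantsHypothesis.Theorems.KPlusLogSqLaw.StaticTridiagonalRealPotential
  (pathDet pathDet_zero pathDet_one pathDet_add_two pathDet_congr eval_pathDet_succ_ne_zero eval_pathDet_add_two
    eval_add_two_of_root_succ eval_ne_zero_of_eval_add_two_eq_zero eval_succ_mul_eval_pos_of_root)
open Summit.ValiantsHypothesis.ValiantsHypothesis.Theorems.KPlusLogSqLaw.StaticTridiagonalRealCut
  (pathDet_split_two_sided)

variable (a : ℕ → ℝ) (d : ℕ → ℕ) (b : ℕ → ℝ) (f : ℕ → ℕ)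

/-! ### §1 The overlap identity (polynomial level, all sizes) -/

/-- Re-indexing a doubly shifted design: shifting by `u` and then by `v` is shifting by `u + v`. [bookkeeping] -/
theorem pathDet_shift_shift (u v n : ℕ) :
    pathDet (fun t => a (t + v + u)) (fun t => d (t + v + u)) (fun t => b (t + v + u)) (fun t => f (t + v + u)) n =
      pathDet (fun t => a (t + (u + v))) (fun t => d (t + (u + v))) (fun t => b (t + (u + v))) (fun t => f (t + (u + v))) n :=
  pathDet_congr (fun t _ => by rw [show t + v + u = t + (u + v) by omega])
    (fun t _ => by rw [show t + v + u = t + (u + v) by omega])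
    (fun t _ => by rw [show t + v + u = t + (u + v) by omega]) (fun t _ => by rw [show t + v + u = t + (u + v) by omega])

/-- **Expansion along the FIRST vertex** (the recurrence read from the left end): `D⁽ᵘ⁾_{n+2} = a_u X^{d_u} · D⁽ᵘ⁺¹⁾_{n+1} − (b_u X^{f_u})² · D⁽ᵘ⁺²⁾_n`.
[folklore; lift-p1's `pathDet_split_two_sided` at `s = 0`] -/
theorem pathDet_shift_expand_first (u n : ℕ) :
    pathDet (fun t => a (t + u)) (fun t => d (t + u)) (fun t => b (t + u)) (fun t => f (t + u)) (n + 2) =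
      (C (a u) * X ^ d u) *
          pathDet (fun t => a (t + (u + 1))) (fun t => d (t + (u + 1))) (fun t => b (t + (u + 1))) (fun t => f (t + (u + 1))) (n + 1) -
        (C (b u) * X ^ f u) ^ 2 *
          pathDet (fun t => a (t + (u + 2))) (fun t => d (t + (u + 2))) (fun t => b (t + (u + 2))) (fun t => f (t + (u + 2))) n := by
  have h := pathDet_split_two_sided (fun t => a (t + u)) (fun t => d (t + u)) (fun t => b (t + u)) (fun t => f (t + u)) 0 n
  simp only [zero_add, pathDet_zero, pathDet_one, mul_one] at h
  rw [show 2 + n = n + 2 by omega] at h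
  rw [h, pathDet_shift_shift a d b f u 1 (n + 1), pathDet_shift_shift a d b f u 2 n]

/-- **THE OVERLAP IDENTITY (all sizes, every interior vertex).**  For the static symmetric tridiagonal monomial design of size
`m = s + 3 + n` and the cut vertex `c = s + 1` (`0`-based):
`D_{s+2} · D⁽ˢ⁺¹⁾_{n+2} = a_c X^{d_c} · D_m + (b_s X^{f_s})² (b_{s+1} X^{f_{s+1}})² · D_s · D⁽ˢ⁺³⁾_n` — the two principal blocks `[0, c]` and
`[c, m)` that OVERLAP in the vertex `c`, against the whole determinant and the two blocks `[0, c − 1)`, `(c + 1, m)` missing `c − 1, c, c + 1`.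
Proof: edge splitting at `{s, s+1}` (lift-p1's `pathDet_split_two_sided`), the last-row recurrence for `D_{s+2}` and the first-row
expansion of `D⁽ˢ⁺¹⁾_{n+2}`; the three identities combine linearly. [folklore: three-term Plücker relation for contiguous minors of a Jacobi matrix] -/
theorem pathDet_overlap (s n : ℕ) :
    pathDet a d b f (s + 2) *
        pathDet (fun t => a (t + (s + 1))) (fun t => d (t + (s + 1))) (fun t => b (t + (s + 1))) (fun t => f (t + (s + 1))) (n + 2) =
      (C (a (s + 1)) * X ^ d (s + 1)) * pathDet a d b f (s + 3 + n) +
        (C (b s) * X ^ f s) ^ 2 * (C (b (s + 1)) * X ^ f (s + 1)) ^ 2 * pathDet a d b f s *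
          pathDet (fun t => a (t + (s + 3))) (fun t => d (t + (s + 3))) (fun t => b (t + (s + 3))) (fun t => f (t + (s + 3))) n := by
  -- (i) last-row recurrence for the left overlapping block
  have h1 := pathDet_add_two a d b f s
  -- (ii) edge splitting of the whole determinant at the edge `{s, s+1}`
  have h2 := pathDet_split_two_sided a d b f s (n + 1)
  rw [show s + 2 + (n + 1) = s + 3 + n by omega] at h2
  -- (iii) first-row expansion of the right overlapping block
  have h3 := pathDet_shift_expand_first a d b f (s + 1) n
  rw [show n + 1 + 1 = n + 2 by rfl] at h2
  rw [show s + 1 + 1 = s + 2 by rfl, show s + 1 + 2 = s + 3 by rfl] at h3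
  linear_combination
    pathDet (fun t => a (t + (s + 1))) (fun t => d (t + (s + 1))) (fun t => b (t + (s + 1))) (fun t => f (t + (s + 1))) (n + 2) * h1 -
      (C (a (s + 1)) * X ^ d (s + 1)) * h2 -
      (C (b s) * X ^ f s) ^ 2 * pathDet a d b f s * h3

/-- The overlap identity, evaluated at a real point. -/
theorem eval_pathDet_overlap (s n : ℕ) (x : ℝ) :
    (pathDet a d b f (s + 2)).eval x *
        (pathDet (fun t => a (t + (s + 1))) (fun t => d (t + (s + 1))) (fun t => b (t + (s + 1))) (fun t => f (t + (s + 1)))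
          (n + 2)).eval x =
      a (s + 1) * x ^ d (s + 1) * (pathDet a d b f (s + 3 + n)).eval x +
        (b s * x ^ f s) ^ 2 * (b (s + 1) * x ^ f (s + 1)) ^ 2 * (pathDet a d b f s).eval x *
          (pathDet (fun t => a (t + (s + 3))) (fun t => d (t + (s + 3))) (fun t => b (t + (s + 3))) (fun t => f (t + (s + 3)))
            n).eval x := by
  have h := congrArg (fun P => Polynomial.eval x P) (pathDet_overlap a d b f s n)
  simpa only [eval_mul, eval_add, eval_pow, eval_C, eval_X] using h

/-! ### §2 The overlap law at a determinant zero (all sizes) -/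

/-- **THE OVERLAP LAW.**  At every zero `x` of `D_m` (`m = s + 3 + n`), the two principal blocks overlapping in the vertex `c = s + 1` have
product `D_{s+2}(x) · D⁽ˢ⁺¹⁾_{n+2}(x) = (b_s x^{f_s})² (b_{s+1} x^{f_{s+1}})² · D_s(x) · D⁽ˢ⁺³⁾_n(x)`. [this file's `pathDet_overlap`] -/
theorem overlap_law (s n : ℕ) {x : ℝ} (hroot : (pathDet a d b f (s + 3 + n)).eval x = 0) :
    (pathDet a d b f (s + 2)).eval x *
        (pathDet (fun t => a (t + (s + 1))) (fun t => d (t + (s + 1))) (fun t => b (t + (s + 1))) (fun t => f (t + (s + 1)))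
          (n + 2)).eval x =
      (b s * x ^ f s) ^ 2 * (b (s + 1) * x ^ f (s + 1)) ^ 2 *
        ((pathDet a d b f s).eval x *
          (pathDet (fun t => a (t + (s + 3))) (fun t => d (t + (s + 3))) (fun t => b (t + (s + 3))) (fun t => f (t + (s + 3)))
            n).eval x) := by
  rw [eval_pathDet_overlap, hroot]
  ring

/-- **Same weak sign.**  At a zero of `D_m` the product of the two overlapping blocks and the product of the two outer blocks have the same
weak sign: their product is a square times the square of the outer product. -/
theorem overlap_sameSign (s n : ℕ) {x : ℝ} (hroot : (pathDet a d b f (s + 3 + n)).eval x = 0) :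
    0 ≤ (pathDet a d b f (s + 2)).eval x *
        (pathDet (fun t => a (t + (s + 1))) (fun t => d (t + (s + 1))) (fun t => b (t + (s + 1))) (fun t => f (t + (s + 1)))
          (n + 2)).eval x *
      ((pathDet a d b f s).eval x *
        (pathDet (fun t => a (t + (s + 3))) (fun t => d (t + (s + 3))) (fun t => b (t + (s + 3))) (fun t => f (t + (s + 3)))
          n).eval x) := by
  rw [overlap_law a d b f s n hroot]
  set B := (pathDet a d b f s).eval x *
    (pathDet (fun t => a (t + (s + 3))) (fun t => d (t + (s + 3))) (fun t => b (t + (s + 3))) (fun t => f (t + (s + 3))) n).eval x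
  have e : (b s * x ^ f s) ^ 2 * (b (s + 1) * x ^ f (s + 1)) ^ 2 * B * B = (b s * x ^ f s * (b (s + 1) * x ^ f (s + 1)) * B) ^ 2 := by
    ring
  rw [e]
  exact sq_nonneg _

/-- **Strict form.**  With nonzero links at the cut vertex and `x ≠ 0`, the product of the two overlapping blocks is positive at a zero
of `D_m` iff the product of the two outer blocks is positive there (and, by `overlap_law`, zero iff zero, negative iff negative). -/
theorem overlap_pos_iff (s n : ℕ) {x : ℝ} (hbs : b s ≠ 0) (hbs1 : b (s + 1) ≠ 0) (hx : x ≠ 0)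
    (hroot : (pathDet a d b f (s + 3 + n)).eval x = 0) :
    0 < (pathDet a d b f (s + 2)).eval x *
        (pathDet (fun t => a (t + (s + 1))) (fun t => d (t + (s + 1))) (fun t => b (t + (s + 1))) (fun t => f (t + (s + 1)))
          (n + 2)).eval x ↔
      0 < (pathDet a d b f s).eval x *
        (pathDet (fun t => a (t + (s + 3))) (fun t => d (t + (s + 3))) (fun t => b (t + (s + 3))) (fun t => f (t + (s + 3)))
          n).eval x := by
  rw [overlap_law a d b f s n hroot]
  have hB : 0 < (b s * x ^ f s) ^ 2 * (b (s + 1) * x ^ f (s + 1)) ^ 2 := by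
    have h1 : b s * x ^ f s ≠ 0 := mul_ne_zero hbs (pow_ne_zero _ hx)
    have h2 : b (s + 1) * x ^ f (s + 1) ≠ 0 := mul_ne_zero hbs1 (pow_ne_zero _ hx)
    positivity
  exact mul_pos_iff_of_pos_left hB

/-! ### §3 Size five: the product form and the inertia class -/

/-- **FIVE-BY-FIVE PRODUCT FORM (identity).**  At a zero `x` of `D₅`, the leading and trailing `3 × 3` minors satisfy
`D₃(x) · D⁽²⁾₃(x) = (b₁ x^{f₁})² (b₂ x^{f₂})² · (a₀ x^{d₀}) · (a₄ x^{d₄})` (the outer blocks are the `1 × 1` corners).  In the normalised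
link weights `U_i` this is `(1 − U₁ − U₂)(1 − U₃ − U₄) = U₂ U₃` (docstring of the file). [this file's `overlap_law` at `s = n = 1`] -/
theorem five_overlap_eq {x : ℝ} (hroot : (pathDet a d b f 5).eval x = 0) :
    (pathDet a d b f 3).eval x *
        (pathDet (fun t => a (t + 2)) (fun t => d (t + 2)) (fun t => b (t + 2)) (fun t => f (t + 2)) 3).eval x =
      (b 1 * x ^ f 1) ^ 2 * (b 2 * x ^ f 2) ^ 2 * ((a 0 * x ^ d 0) * (a 4 * x ^ d 4)) := by
  have h := overlap_law a d b f 1 1 (x := x) (by simpa using hroot)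
  rw [pathDet_one, pathDet_one] at h
  simpa only [eval_mul, eval_C, eval_pow, eval_X, zero_add] using h

/-- **FIVE-BY-FIVE PRODUCT FORM (sign): for a DEFINITE IRREDUCIBLE `5 × 5` design, at every positive determinant zero the leading and the
trailing `3 × 3` minors are nonzero and of the SAME SIGN — their product is the positive monomial `b₁²b₂²a₀a₄ · x^{2f₁+2f₂+d₀+d₄}`.** -/
theorem five_overlap_pos (ha : ∀ t, 0 < a t) (hb : ∀ t, b t ≠ 0) {x : ℝ} (hx : 0 < x)
    (hroot : (pathDet a d b f 5).eval x = 0) :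
    0 < (pathDet a d b f 3).eval x *
        (pathDet (fun t => a (t + 2)) (fun t => d (t + 2)) (fun t => b (t + 2)) (fun t => f (t + 2)) 3).eval x := by
  rw [five_overlap_eq a d b f hroot]
  have h1 : b 1 * x ^ f 1 ≠ 0 := mul_ne_zero (hb 1) (pow_ne_zero _ hx.ne')
  have h2 : b 2 * x ^ f 2 ≠ 0 := mul_ne_zero (hb 2) (pow_ne_zero _ hx.ne')
  have h3 : 0 < a 0 * x ^ d 0 := mul_pos (ha 0) (pow_pos hx _)
  have h4 : 0 < a 4 * x ^ d 4 := mul_pos (ha 4) (pow_pos hx _)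
  positivity

/-- At a positive determinant zero of a definite irreducible `5 × 5` design the TRAILING `3 × 3` minor does not vanish (the leading one
does not either: `StaticTridiagonalRealPotential.eval_ne_zero_of_eval_add_two_eq_zero`). -/
theorem five_trailing_three_ne_zero (ha : ∀ t, 0 < a t) (hb : ∀ t, b t ≠ 0) {x : ℝ} (hx : 0 < x)
    (hroot : (pathDet a d b f 5).eval x = 0) :
    (pathDet (fun t => a (t + 2)) (fun t => d (t + 2)) (fun t => b (t + 2)) (fun t => f (t + 2)) 3).eval x ≠ 0 := by
  intro h
  have := five_overlap_pos a d b f ha hb hx hroot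
  rw [h, mul_zero] at this
  exact lt_irrefl _ this

/-- **CLASS ZERO ⇔ POSITIVE OVERLAPPING MINORS.**  At a positive determinant zero `x` of a definite irreducible `5 × 5` design, the leading
`3 × 3` minor is positive iff ALL proper leading minors `D₀, …, D₄` are positive at `x` (no negative LDLᵀ pivot: the zero is in the bottom
inertia class, where the singular matrix is positive semidefinite; at most two such zeros by `…StaticTridiagonalDefiniteInterval`).  With
`five_overlap_pos`: iff the trailing `3 × 3` minor is positive. -/
theorem five_class_zero_iff (ha : ∀ t, 0 < a t) (hb : ∀ t, b t ≠ 0) {x : ℝ} (hx : 0 < x)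
    (hroot : (pathDet a d b f 5).eval x = 0) :
    0 < (pathDet a d b f 3).eval x ↔ ∀ k, k ≤ 4 → 0 < (pathDet a d b f k).eval x := by
  constructor
  · intro h3 k hk
    have h0 : 0 < (pathDet a d b f 0).eval x := by rw [pathDet_zero, eval_one]; exact one_pos
    have h1 : 0 < (pathDet a d b f 1).eval x := by
      rw [pathDet_one, eval_mul, eval_C, eval_pow, eval_X]; exact mul_pos (ha 0) (pow_pos hx _)
    -- `D₄(x) > 0`: same-sign lemma at the zero of `D₅`
    have h4 : 0 < (pathDet a d b f 4).eval x := by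
      have h := eval_succ_mul_eval_pos_of_root a d b f ha hb 3 hx hroot
      exact (mul_pos_iff_of_pos_right h3).mp h
    -- `D₂(x) > 0`: otherwise `D₃ = a₂x^{d₂}·D₂ − (b₁x^{f₁})²·D₁ < 0`
    have h2 : 0 < (pathDet a d b f 2).eval x := by
      by_contra hle
      push Not at hle
      have e := eval_pathDet_add_two a d b f 1 x
      rw [show 1 + 2 = 3 from rfl, show 1 + 1 = 2 from rfl] at e
      have hA : 0 ≤ a 2 * x ^ d 2 := (mul_pos (ha 2) (pow_pos hx _)).le
      have hB : 0 < (b 1 * x ^ f 1) ^ 2 := by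
        have : b 1 * x ^ f 1 ≠ 0 := mul_ne_zero (hb 1) (pow_ne_zero _ hx.ne')
        positivity
      have h5 : a 2 * x ^ d 2 * (pathDet a d b f 2).eval x ≤ 0 := mul_nonpos_of_nonneg_of_nonpos hA hle
      have h6 : 0 < (b 1 * x ^ f 1) ^ 2 * (pathDet a d b f 1).eval x := mul_pos hB h1
      linarith
    interval_cases k
    · exact h0
    · exact h1
    · exact h2
    · exact h3
    · exact h4
  · intro h; exact h 3 (by norm_num)

/-- **CLASS ONE ⇔ NEGATIVE OVERLAPPING MINORS.**  At a positive determinant zero `x` of a definite irreducible `5 × 5` design with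
`D₃(x) < 0`: `D₄(x) < 0 < D₁(x)` — so the sequence `D₀, D₁, D₂, D₃, D₄` of proper leading minors has exactly ONE sign change at `x` whatever
the sign of `D₂(x)` (between `D₁` and `D₂` if `D₂(x) < 0`, between `D₂` and `D₃` otherwise): one negative LDLᵀ pivot, the zero is in inertia
class `1` (the only other class at `m = 5`). -/
theorem five_class_one (ha : ∀ t, 0 < a t) (hb : ∀ t, b t ≠ 0) {x : ℝ} (hx : 0 < x)
    (hroot : (pathDet a d b f 5).eval x = 0) (h3 : (pathDet a d b f 3).eval x < 0) :
    (pathDet a d b f 4).eval x < 0 ∧ 0 < (pathDet a d b f 1).eval x := by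
  refine ⟨?_, ?_⟩
  · have h := eval_succ_mul_eval_pos_of_root a d b f ha hb 3 hx hroot
    -- `D₄ D₃ > 0` with `D₃ < 0`
    by_contra hle
    push Not at hle
    exact absurd h (not_lt.2 (mul_nonpos_of_nonneg_of_nonpos hle h3.le))
  · rw [pathDet_one, eval_mul, eval_C, eval_pow, eval_X]; exact mul_pos (ha 0) (pow_pos hx _)

/-- **DICHOTOMY at `m = 5`.**  At a positive determinant zero of a definite irreducible `5 × 5` design, either both overlapping `3 × 3`
minors are positive (class `0`) or both are negative (class `1`). -/
theorem five_overlap_dichotomy (ha : ∀ t, 0 < a t) (hb : ∀ t, b t ≠ 0) {x : ℝ} (hx : 0 < x)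
    (hroot : (pathDet a d b f 5).eval x = 0) :
    (0 < (pathDet a d b f 3).eval x ∧
        0 < (pathDet (fun t => a (t + 2)) (fun t => d (t + 2)) (fun t => b (t + 2)) (fun t => f (t + 2)) 3).eval x) ∨
      ((pathDet a d b f 3).eval x < 0 ∧
        (pathDet (fun t => a (t + 2)) (fun t => d (t + 2)) (fun t => b (t + 2)) (fun t => f (t + 2)) 3).eval x < 0) := by
  have h := five_overlap_pos a d b f ha hb hx hroot
  rcases lt_trichotomy ((pathDet a d b f 3).eval x) 0 with h3 | h3 | h3
  · right
    refine ⟨h3, ?_⟩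
    by_contra hle; push Not at hle
    exact absurd h (not_lt.2 (mul_nonpos_of_nonpos_of_nonneg h3.le hle))
  · rw [h3, zero_mul] at h; exact absurd h (lt_irrefl 0)
  · left
    exact ⟨h3, (mul_pos_iff_of_pos_left h3).mp h⟩

end StaticTridiagonalRealOverlap

end Summit.ValiantsHypothesis.ValiantsHypothesis.Theorems.KPlusLogSqLaw
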